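import Literature.Barriers.PneNP.TSPExtensionComplexityMatchingFace
import Literature.Barriers.PneNP.TSPExtensionComplexityHyperplaneBound
import Mathlib.Analysis.SpecialFunctions.Pow.Real
import Mathlib.Analysis.SpecialFunctions.Log.Base
import HarnessLib

/-!
# Rothvoß's TSP bound assembled: `xc(TSP(n)) ≥ 2^{Ω(n)}` from the rectangle bound (Lemma 6)

Support file for the fact `Literature.Barriers.PneNP.Rothvoss2017_tsp`. Rothvoß 2017, §2
(PDF pp. 6–7) derives Thm. 1 / Cor. 2 from three ingredients: Yannakakis' factorization
(Thm. 4) and the hyperplane separation bound (Lemma 5) — `HasEFOfSize.weight_slack_le` of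
`…HyperplaneBound.lean` —, the odd-cut slack matrix `S_{UM} = |δ(U) ∩ M| - 1` realised on (a
face of) the TSP polytope — `exists_matching_slack_data` of `…MatchingFace.lean` —, and the
rweight matrix `W` (`1/|Q_3|` on `Q_3`, `-1/((k-1)|Q_k|)` on `Q_k`, `-∞` on `Q_1`) with
`⟨W, S⟩ = 1` together with **Lemma 6**: `⟨W, R⟩ ≤ 2^{-δn}` for every rectangle `R` (the hard
part, §3). This file carries out that assembly with Lemma 6 as an explicit HYPOTHESIS, in the
rectangle form in which §3 proves it (Lemma 7: `μ_3(R) ≤ μ_k(R)/(k-1) + 2^{-δm}` for rectangles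
`R` with `μ_1(R) = 0`, `k` a large odd constant, `n = 3m(k-3) + 2k`, cuts of size
`t = (m+1)(k-3)/2 + 3`):

* `OddSet n`, `PMatch n`, `cc U M = |δ(U) ∩ M|`, `Qset n t ℓ` (= `Q_ℓ` on the `t`-cuts),
  `mu n t ℓ X Y = μ_ℓ(X × Y)`;
* `one_le_pairing_of_weights`, `one_le_of_weights` — §2's chain for GENERAL weights
  `W = A - B` with `A ≥ 0` a probability vector supported on `{|δ(U) ∩ M| = 3}` and `B ≥ 0`
  supported on `{|δ(U) ∩ M| = k}` with `(k-1) Σ B ≤ 1` (then `⟨W, S⟩ = 2 - (k-1) Σ B ≥ 1`):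
  if every rectangle avoiding `Q_1` has `W`-rweight `≤ α`, every EF of `TSP(3n + pad)` of size `r`
  has `1 ≤ α · n² · (r + 1)`. REMARK (formalisation route): with `A`, `B/(k-1)` the LAWS of the
  pairs `(U, M)` produced by Rothvoß's two sampling procedures of §3.2 (random partition `T`,
  random `3`- resp. `k`-matching between `C` and `D`, random extensions), the rectangle bound is
  LITERALLY the inequality `E_{T,H}[p·p] ≤ (400/k²) E_{T,F}[p·p] + 2^{-δm}` proved in §§3.3–3.6, so
  the identification of these laws with the uniform measures `μ_3`, `μ_k` (§3.2, a symmetry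
  argument) is not needed on this route;
* `rothvoss2017_tsp_of_weights` — the asymptotics: such weights for all large odd `m`
  (`n = 3m(k-3) + 2k`) with `α = 2^{-δm}` give `Rothvoss2017_tsp` (`c = δ/(18(k-3))`);
* the printed (uniform) instance: `rweight = 1_{Q_3}/|Q_3| - 1_{Q_k}/((k-1)|Q_k|)` on the `t`-cuts,
  `pairMatching n` (so `Q_3 ≠ ∅`: `qset_three_nonempty`), `sum_weight_rectangle`
  (`= μ_3 - μ_k/(k-1)`), and `rothvoss2017_tsp_of_rectangle_bound` — Lemma 7's statement
  `μ_3(R) ≤ μ_k(R)/(k-1) + 2^{-δm}` for rectangles `R` with `μ_1(R) = 0` implies `Rothvoss2017_tsp`.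

Nothing here is a new named fact: the rectangle bound enters as a hypothesis of the theorems,
spelled out inline; its discharge is Rothvoß's §3 (Lemma 6 / Lemma 7).

## Sources

* [Rothvoss2017] arXiv:1311.2369 (held): §2, PDF pp. 6–7 (the choice of `k, n, t`, `Q_ℓ`,
  `μ_ℓ`, `W`; "⟨W,S⟩ = 0 + (3-1)|Q_3| (1/|Q_3|) - (k-1)|Q_k| (1/(k-1)) (1/|Q_k|) = 1"; Lemma 6;
  "xc(P_M) ≥ ⟨W,S⟩/(‖S‖_∞ max ⟨W,R⟩) ≥ 1/(n 2^{-δn}) ≥ 2^{Ω(n)}"), Lemma 7 (PDF p. 8), Cor. 2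
  (PDF p. 4).
-/

noncomputable section

namespace Literature.Barriers.PneNP

open Finset Filter Literature.Combinatorics.SimpleGraph.CycleSpace

/-! ### Cuts, matchings, `Q_ℓ`, `μ_ℓ` -/

/-- The odd vertex sets of `K_n` (the rows of the odd-cut slack matrix). [cite: Rothvoss2017, §2 (PDF p. 5)] -/
abbrev OddSet (n : ℕ) : Type := {U : Finset (Fin n) // Odd U.card}

/-- The perfect matchings of `K_n` (the columns). [cite: Rothvoss2017, §2 (PDF p. 5)] -/
abbrev PMatch (n : ℕ) : Type := {M : Finset (Sym2 (Fin n)) // IsPMOn (Finset.univ : Finset (Fin n)) M}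

/-- `OddSet n` is finite. [folklore] -/
noncomputable instance (n : ℕ) : Fintype (OddSet n) := by classical exact Subtype.fintype _

/-- `PMatch n` is finite. [folklore] -/
instance (n : ℕ) : Fintype (PMatch n) := Subtype.fintype _

variable {n : ℕ}

/-- `cc U M = |δ(U) ∩ M|`, the number of matching edges crossing `U`. [cite: Rothvoss2017, §2 (PDF p. 5)] -/
def cc (U : OddSet n) (M : PMatch n) : ℕ := (M.1.filter (Crosses U.1)).card

variable (n) in
/-- `Q_ℓ` on the `t`-cuts: the pairs `(U, M)` with `|U| = t` and `|δ(U) ∩ M| = ℓ`.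
[cite: Rothvoss2017, §2 (PDF p. 6)] -/
def Qset (t ℓ : ℕ) : Finset (OddSet n × PMatch n) :=
  univ.filter fun p => p.1.1.card = t ∧ cc p.1 p.2 = ℓ

variable (n) in
/-- `μ_ℓ(X × Y) = |(X × Y) ∩ Q_ℓ| / |Q_ℓ|`, the uniform measure on `Q_ℓ` of a rectangle.
[cite: Rothvoss2017, §2 (PDF p. 6)] -/
def mu (t ℓ : ℕ) (X : Finset (OddSet n)) (Y : Finset (PMatch n)) : ℝ :=
  ((X ×ˢ Y) ∩ Qset n t ℓ).card / (Qset n t ℓ).card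

/-- Membership in `Qset`. [folklore] -/
theorem mem_Qset_iff {t ℓ : ℕ} {p : OddSet n × PMatch n} :
    p ∈ Qset n t ℓ ↔ p.1.1.card = t ∧ cc p.1 p.2 = ℓ := by
  simp [Qset]

/-- Summing an indicator-weighted function over all pairs. [folklore] -/
theorem sum_sum_ite_mem (Q : Finset (OddSet n × PMatch n)) (f : OddSet n → PMatch n → ℝ) :
    ∑ U, ∑ M, (if (U, M) ∈ Q then f U M else 0) = ∑ p ∈ Q, f p.1 p.2 := by
  rw [← Finset.sum_product' (f := fun U M => if (U, M) ∈ Q then f U M else 0), univ_product_univ,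
    ← Finset.sum_filter]
  congr 1
  ext p
  simp

/-- Summing an indicator-weighted function over a rectangle. [folklore] -/
theorem sum_product_ite_mem (Q : Finset (OddSet n × PMatch n)) (X : Finset (OddSet n))
    (Y : Finset (PMatch n)) (f : OddSet n → PMatch n → ℝ) :
    ∑ U ∈ X, ∑ M ∈ Y, (if (U, M) ∈ Q then f U M else 0) = ∑ p ∈ (X ×ˢ Y) ∩ Q, f p.1 p.2 := by
  rw [← Finset.sum_product' (f := fun U M => if (U, M) ∈ Q then f U M else 0),
    ← Finset.filter_mem_eq_inter, Finset.sum_filter]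

/-! ### `⟨W, S⟩ ≥ 1` for weights supported on `Q_3` and `Q_k` -/

/-- **`⟨W, S⟩ = 2 Σ A - (k-1) Σ B ≥ 1`** for `W = A - B` with `A` supported on the entries with
`|δ(U) ∩ M| = 3` and summing to `1`, `B` supported on the entries with `|δ(U) ∩ M| = k` with
`(k - 1) Σ B ≤ 1` (as printed, for the uniform measures: `⟨W,S⟩ = (3-1)|Q_3| (1/|Q_3|) -
(k-1)|Q_k| (1/((k-1)|Q_k|)) = 1`). [cite: Rothvoss2017, §2 (PDF p. 6, eq. (2))] -/
theorem one_le_pairing_of_weights {k : ℕ} (A B : OddSet n → PMatch n → ℝ)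
    (hA3 : ∀ U M, A U M ≠ 0 → cc U M = 3) (hBk : ∀ U M, B U M ≠ 0 → cc U M = k)
    (hAsum : ∑ U, ∑ M, A U M = 1) (hBsum : (∑ U, ∑ M, B U M) * ((k : ℝ) - 1) ≤ 1) :
    1 ≤ ∑ U, ∑ M, (A U M - B U M) * ((cc U M : ℝ) - 1) := by
  have hA : ∀ U M, A U M * ((cc U M : ℝ) - 1) = 2 * A U M := by
    intro U M
    by_cases h : A U M = 0
    · rw [h]; ring
    · rw [hA3 U M h]; norm_num; ring
  have hB : ∀ U M, B U M * ((cc U M : ℝ) - 1) = ((k : ℝ) - 1) * B U M := by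
    intro U M
    by_cases h : B U M = 0
    · rw [h]; ring
    · rw [hBk U M h]; ring
  simp only [sub_mul, hA, hB, sum_sub_distrib, ← mul_sum]
  linarith

/-! ### From a rectangle bound to `1 ≤ α · n² · (r + 1)` -/

/-- `|Sym2 (Fin n)| ≤ n²`. [folklore] -/
theorem card_sym2_fin_le (n : ℕ) : Fintype.card (Sym2 (Fin n)) ≤ n ^ 2 := by
  classical
  rw [← Finset.card_univ, ← Finset.sym2_univ, Finset.card_sym2, Finset.card_univ, Fintype.card_fin,
    Nat.choose_two_right]
  simp only [Nat.add_sub_cancel]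
  rcases Nat.eq_zero_or_pos n with rfl | hn
  · simp
  · refine Nat.div_le_of_le_mul ?_
    nlinarith

/-- The slacks are at most `n²`: `|δ(U) ∩ M| - 1 ≤ |M| ≤ |Sym2 (Fin n)| ≤ n²`. [folklore] -/
theorem cc_sub_one_le (U : OddSet n) (M : PMatch n) : (cc U M : ℝ) - 1 ≤ (n : ℝ) ^ 2 := by
  have h1 : cc U M ≤ M.1.card := card_filter_le _ _
  have h2 : M.1.card ≤ Fintype.card (Sym2 (Fin n)) := card_le_univ _
  have h3 := card_sym2_fin_le n
  have : (cc U M : ℝ) ≤ (n : ℝ) ^ 2 := by exact_mod_cast h1.trans (h2.trans h3)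
  linarith

/-- **Rothvoß's chain of inequalities** `xc ≥ ⟨W,S⟩ / (‖S‖_∞ · max_R ⟨W,R⟩)` in our currency,
for general weights: let `W = A - B` with `A` supported on `{|δ(U) ∩ M| = 3}` and
`Σ A = 1`, `B` supported on `{|δ(U) ∩ M| = k}` with `(k-1) Σ B ≤ 1`, and suppose every
rectangle `X × Y` of odd cuts and perfect matchings avoiding `Q_1` (no entry with
`|δ(U) ∩ M| = 1`) has `Σ_{X × Y} W ≤ α`. Then every extended formulation of `TSP(3n + pad)` of
size `r` has `1 ≤ α · n² · (r + 1)` (Yannakakis' face `exists_matching_slack_data`, then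
`HasEFOfSize.weight_slack_le` with `‖S‖_∞ ≤ n²`). [cite: Rothvoss2017, §2 (PDF pp. 6–7)] -/
theorem one_le_of_weights {k : ℕ} (hn : 0 < n) (A B : OddSet n → PMatch n → ℝ)
    (hA3 : ∀ U M, A U M ≠ 0 → cc U M = 3) (hBk : ∀ U M, B U M ≠ 0 → cc U M = k)
    (hAsum : ∑ U, ∑ M, A U M = 1) (hBsum : (∑ U, ∑ M, B U M) * ((k : ℝ) - 1) ≤ 1) {α : ℝ}
    (hrect : ∀ (X : Finset (OddSet n)) (Y : Finset (PMatch n)),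
      (∀ U ∈ X, ∀ M ∈ Y, cc U M ≠ 1) → ∑ U ∈ X, ∑ M ∈ Y, (A U M - B U M) ≤ α)
    {pad r : ℕ} (h : HasEFOfSize (tspPolytope (3 * n + pad)) r) :
    1 ≤ α * (n : ℝ) ^ 2 * (r + 1) := by
  classical
  obtain ⟨v, c, d, hv, hvalid, hslack⟩ := exists_matching_slack_data n pad hn
  have hslack' : ∀ (U : OddSet n) (M : PMatch n), d U - c U ⬝ᵥ v M = (cc U M : ℝ) - 1 :=
    fun U M => hslack U M
  have key := h.weight_slack_le v hv c d hvalid (fun U M => A U M - B U M) (α := α)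
    (s := (n : ℝ) ^ 2) (by positivity) (fun U M => (hslack' U M) ▸ cc_sub_one_le U M)
    (fun X Y hXY => hrect X Y fun U hU M hM h1 => hXY U hU M hM (by rw [hslack', h1]; norm_num))
  calc (1 : ℝ) ≤ ∑ U : OddSet n, ∑ M : PMatch n, (A U M - B U M) * ((cc U M : ℝ) - 1) :=
        one_le_pairing_of_weights A B hA3 hBk hAsum hBsum
    _ = ∑ U : OddSet n, ∑ M : PMatch n, (A U M - B U M) * (d U - c U ⬝ᵥ v M) := by
        simp only [hslack']
    _ ≤ α * (n : ℝ) ^ 2 * (r + 1) := key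

/-! ### Rothvoß's parameters `n = 3m(k-3) + 2k`, `t = (m+1)(k-3)/2 + 3` -/

/-- Parities and sizes of Rothvoß's parameters (`k ≥ 5` odd, `m ≥ 1` odd): `n` is even, `t` is
odd, `3 ≤ t` and `t + 3 ≤ n`. [cite: Rothvoss2017, §2 (PDF p. 6)] -/
theorem rothvoss_params {k m : ℕ} (hk : 5 ≤ k) (hko : k % 2 = 1) (hm : 1 ≤ m) :
    (3 * m * (k - 3) + 2 * k) % 2 = 0 ∧ ((m + 1) / 2 * (k - 3) + 3) % 2 = 1 ∧
      3 ≤ (m + 1) / 2 * (k - 3) + 3 ∧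
      (m + 1) / 2 * (k - 3) + 3 + 3 ≤ 3 * m * (k - 3) + 2 * k := by
  obtain ⟨j, hj⟩ : ∃ j, k - 3 = 2 * j := ⟨(k - 3) / 2, by omega⟩
  set a := (m + 1) / 2 with ha
  have ha2 : 2 * a ≤ m + 1 := by omega
  have ham : a ≤ m := by omega
  rw [hj]
  refine ⟨?_, ?_, by omega, ?_⟩
  · have : 3 * m * (2 * j) + 2 * k = 2 * (3 * m * j + k) := by ring
    rw [this]; simp
  · have : a * (2 * j) + 3 = 2 * (a * j + 1) + 1 := by ring
    rw [this]; omega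
  · have h1 : a * (2 * j) ≤ m * (2 * j) := Nat.mul_le_mul_right _ ham
    have h2 : m * (2 * j) ≤ 3 * m * (2 * j) := by nlinarith
    omega

/-! ### Asymptotics: exponential versus polynomial -/

/-- For `c > 0` and any `C`, eventually `2 N² ≤ 2^{c N - C}`. [folklore] -/
theorem eventually_two_mul_sq_le_two_rpow {c : ℝ} (hc : 0 < c) (C : ℝ) :
    ∀ᶠ N : ℕ in atTop, 2 * (N : ℝ) ^ 2 ≤ (2 : ℝ) ^ (c * N - C) := by
  have hb : 0 < c * Real.log 2 := mul_pos hc (Real.log_pos one_lt_two)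
  have hε : 0 < (2 : ℝ) ^ (-C) / 2 := by positivity
  have ho := (isLittleO_pow_exp_pos_mul_atTop 2 hb).def hε
  have hreal : ∀ᶠ x : ℝ in atTop, 2 * x ^ 2 ≤ (2 : ℝ) ^ (c * x - C) := by
    filter_upwards [ho, eventually_ge_atTop (0 : ℝ)] with x hx hx0
    rw [Real.norm_of_nonneg (by positivity), Real.norm_of_nonneg (Real.exp_pos _).le] at hx
    have hexp : Real.exp (c * Real.log 2 * x) = (2 : ℝ) ^ (c * x) := by
      rw [Real.rpow_def_of_pos two_pos]; congr 1; ring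
    rw [hexp] at hx
    have hsplit : (2 : ℝ) ^ (c * x - C) = (2 : ℝ) ^ (c * x) * (2 : ℝ) ^ (-C) := by
      rw [sub_eq_add_neg, Real.rpow_add two_pos]
    rw [hsplit]
    nlinarith [Real.rpow_pos_of_pos two_pos (c * x), Real.rpow_pos_of_pos two_pos (-C)]
  exact tendsto_natCast_atTop_atTop.eventually hreal

/-- **Rothvoß 2017, Cor. 2, assembled (general weights): `xc(TSP(N)) ≥ 2^{Ω(N)}`.**
Hypothesis: for some `k ≥ 4`, `δ > 0`, `m₀`, and every odd `m ≥ m₀` (`n := 3m(k-3) + 2k`),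
there are weights `A, B` on (odd cuts) × (perfect matchings of `K_n`), `A` supported on
`{|δ(U) ∩ M| = 3}` with `Σ A = 1`, `B` supported on `{|δ(U) ∩ M| = k}` with `(k-1) Σ B ≤ 1`, such
that every rectangle `X × Y` avoiding `Q_1` has `Σ_{X×Y} (A - B) ≤ 2^{-δm}` — Rothvoß's Lemma 6
for `W = A - B` (printed: `A = μ_3`-density, `B = μ_k`-density`/(k-1)`; equally: the laws of
§3.2's sampling procedures, see the file header). Conclusion: the named fact `Rothvoss2017_tsp`,
with `c = δ / (18 (k-3))`. Proof: §2's chain (`one_le_of_weights`) at the largest admissible odd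
`m` with `3n ≤ N` (padding the rest), then exponential versus polynomial.
[cite: Rothvoss2017, Lemma 6 and §2 (PDF pp. 6–7), Cor. 2 (PDF p. 4)] -/
theorem rothvoss2017_tsp_of_weights {k : ℕ} (hk : 4 ≤ k) {δ : ℝ} (hδ : 0 < δ) {m₀ : ℕ}
    (hW : ∀ m : ℕ, m₀ ≤ m → m % 2 = 1 →
      ∃ A B : OddSet (3 * m * (k - 3) + 2 * k) → PMatch (3 * m * (k - 3) + 2 * k) → ℝ,
        (∀ U M, A U M ≠ 0 → cc U M = 3) ∧ (∀ U M, B U M ≠ 0 → cc U M = k) ∧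
        (∑ U, ∑ M, A U M = 1) ∧ (∑ U, ∑ M, B U M) * ((k : ℝ) - 1) ≤ 1 ∧
        ∀ (X : Finset (OddSet (3 * m * (k - 3) + 2 * k)))
          (Y : Finset (PMatch (3 * m * (k - 3) + 2 * k))),
          (∀ U ∈ X, ∀ M ∈ Y, cc U M ≠ 1) →
          ∑ U ∈ X, ∑ M ∈ Y, (A U M - B U M) ≤ (2 : ℝ) ^ (-(δ * m))) :
    Rothvoss2017_tsp := by
  -- constants
  set L : ℕ := 18 * (k - 3) with hL
  have hL0 : 0 < L := by rw [hL]; omega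
  set c : ℝ := δ / (18 * ((k : ℝ) - 3)) with hc
  have hk3 : (0 : ℝ) < (k : ℝ) - 3 := by
    have : (4 : ℝ) ≤ k := by exact_mod_cast hk
    linarith
  have hcpos : 0 < c := by rw [hc]; positivity
  set C : ℝ := δ * (6 * k / (9 * ((k : ℝ) - 3)) + 3) with hC
  refine ⟨c, hcpos, ?_⟩
  -- thresholds: `N ≥ N₁` makes `q ≥ m₀ + 2`; and the growth estimate
  set N₁ : ℕ := 6 * k + L * (m₀ + 2) with hN₁
  filter_upwards [eventually_ge_atTop N₁, eventually_two_mul_sq_le_two_rpow hcpos C] with N hN hgrow r hr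
  -- the parameters
  set q : ℕ := (N - 6 * k) / L with hq
  have hq2 : m₀ + 2 ≤ q := by
    rw [hq, Nat.le_div_iff_mul_le hL0]
    have : L * (m₀ + 2) ≤ N - 6 * k := by omega
    linarith [Nat.mul_comm L (m₀ + 2)]
  set m : ℕ := 2 * q - 1 with hm
  have hm1 : 1 ≤ m := by omega
  have hmo : m % 2 = 1 := by omega
  have hm₀ : m₀ ≤ m := by omega
  set n : ℕ := 3 * m * (k - 3) + 2 * k with hn
  have hn0 : 0 < n := by rw [hn]; omega
  -- `3n ≤ N`
  have hqL : L * q ≤ N - 6 * k := by rw [hq]; exact Nat.mul_div_le _ _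
  have h3n : 3 * n ≤ N := by
    have h1 : 3 * n ≤ 9 * (2 * q) * (k - 3) + 6 * k := by
      rw [hn, hm]
      have : 2 * q - 1 ≤ 2 * q := Nat.sub_le _ _
      nlinarith
    have h2 : 9 * (2 * q) * (k - 3) = L * q := by rw [hL]; ring
    omega
  obtain ⟨pad, hpad⟩ : ∃ pad, N = 3 * n + pad := ⟨N - 3 * n, by omega⟩
  rw [hpad] at hr
  -- §2's chain at these parameters
  obtain ⟨A, B, hA3, hBk, hAsum, hBsum, hrect⟩ := hW m hm₀ hmo
  have hone : 1 ≤ (2 : ℝ) ^ (-(δ * m)) * (n : ℝ) ^ 2 * (r + 1) :=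
    one_le_of_weights (n := n) hn0 A B hA3 hBk hAsum hBsum hrect hr
  -- `m` is linear in `N`
  have hmreal : (N : ℝ) / (9 * ((k : ℝ) - 3)) - (6 * k / (9 * ((k : ℝ) - 3)) + 3) ≤ m := by
    have hdiv : ((N - 6 * k : ℕ) : ℝ) < L * (q + 1) := by
      have := Nat.lt_mul_div_succ (N - 6 * k) hL0
      rw [← hq] at this
      exact_mod_cast this
    have hsub : ((N - 6 * k : ℕ) : ℝ) = N - 6 * k := by
      rw [Nat.cast_sub (by omega)]; push_cast; ring
    rw [hsub] at hdiv
    have hLr : (L : ℝ) = 18 * ((k : ℝ) - 3) := by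
      rw [hL]; push_cast; rw [Nat.cast_sub (by omega)]; push_cast; ring
    rw [hLr] at hdiv
    have hmq : (m : ℝ) = 2 * q - 1 := by
      rw [hm, Nat.cast_sub (by omega)]; push_cast; ring
    rw [hmq]
    have hk9 : (0 : ℝ) < 9 * ((k : ℝ) - 3) := by positivity
    have h1 : ((N : ℝ) - 6 * k) / (9 * ((k : ℝ) - 3)) < 2 * q + 2 := by
      rw [div_lt_iff₀ hk9]; nlinarith
    have h2 : (N : ℝ) / (9 * ((k : ℝ) - 3)) - (6 * k / (9 * ((k : ℝ) - 3)) + 3) =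
        ((N : ℝ) - 6 * k) / (9 * ((k : ℝ) - 3)) - 3 := by
      rw [sub_div]; ring
    rw [h2]; linarith
  -- hence `2^{δ m} ≥ 2^{2cN - C} = 2^{cN} · 2^{cN - C} ≥ 2^{cN} · 2N²`
  have hδm : 2 * c * N - C ≤ δ * m := by
    have : δ * ((N : ℝ) / (9 * ((k : ℝ) - 3)) - (6 * k / (9 * ((k : ℝ) - 3)) + 3)) ≤ δ * m :=
      mul_le_mul_of_nonneg_left hmreal hδ.le
    have hcN : 2 * c * N = δ * ((N : ℝ) / (9 * ((k : ℝ) - 3))) := by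
      rw [hc]; field_simp; ring
    rw [hcN, hC]
    linarith
  have hpow : (2 : ℝ) ^ (c * N) * (2 * (N : ℝ) ^ 2) ≤ (2 : ℝ) ^ (δ * m) := by
    calc (2 : ℝ) ^ (c * N) * (2 * (N : ℝ) ^ 2) ≤ (2 : ℝ) ^ (c * N) * (2 : ℝ) ^ (c * N - C) :=
          mul_le_mul_of_nonneg_left hgrow (Real.rpow_pos_of_pos two_pos _).le
      _ = (2 : ℝ) ^ (2 * c * N - C) := by
          rw [← Real.rpow_add two_pos]; congr 1; ring
      _ ≤ (2 : ℝ) ^ (δ * m) := Real.rpow_le_rpow_of_exponent_le one_le_two hδm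
  -- and `2^{δm} ≤ n² (r + 1) ≤ N² (r + 1)` from `hone`
  have hbound : (2 : ℝ) ^ (δ * m) ≤ (N : ℝ) ^ 2 * (r + 1) := by
    have h2 : (2 : ℝ) ^ (δ * m) * (2 : ℝ) ^ (-(δ * m)) = 1 := by
      rw [← Real.rpow_add two_pos]; simp
    have h1 : (2 : ℝ) ^ (δ * m) * 1 ≤
        (2 : ℝ) ^ (δ * m) * ((2 : ℝ) ^ (-(δ * m)) * (n : ℝ) ^ 2 * (r + 1)) :=
      mul_le_mul_of_nonneg_left hone (Real.rpow_pos_of_pos two_pos _).le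
    have h1' : (2 : ℝ) ^ (δ * m) ≤ (n : ℝ) ^ 2 * (r + 1) := by
      have : (2 : ℝ) ^ (δ * m) * ((2 : ℝ) ^ (-(δ * m)) * (n : ℝ) ^ 2 * (r + 1)) =
          ((2 : ℝ) ^ (δ * m) * (2 : ℝ) ^ (-(δ * m))) * ((n : ℝ) ^ 2 * (r + 1)) := by ring
      rw [this, h2, one_mul, mul_one] at h1
      exact h1
    have h3 : (n : ℝ) ^ 2 ≤ (N : ℝ) ^ 2 := by
      have : (n : ℝ) ≤ N := by exact_mod_cast (by omega : n ≤ N)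
      nlinarith
    have h4 : (0 : ℝ) ≤ (r : ℝ) + 1 := by positivity
    exact h1'.trans (mul_le_mul_of_nonneg_right h3 h4)
  -- conclude: `2 · 2^{cN} ≤ r + 1`
  have hN0 : (0 : ℝ) < (N : ℝ) ^ 2 := by
    have : (1 : ℝ) ≤ N := by
      have : 1 ≤ N := by omega
      exact_mod_cast this
    positivity
  have hfinal : (2 : ℝ) ^ (c * N) * 2 ≤ r + 1 := by
    have := hpow.trans hbound
    rw [show (2 : ℝ) ^ (c * N) * (2 * (N : ℝ) ^ 2) = ((2 : ℝ) ^ (c * N) * 2) * (N : ℝ) ^ 2 by ring,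
      mul_comm ((N : ℝ) ^ 2)] at this
    exact le_of_mul_le_mul_right this hN0
  have hone' : (1 : ℝ) ≤ (2 : ℝ) ^ (c * N) := Real.one_le_rpow one_le_two (by positivity)
  linarith

/-! ### The printed instance: uniform measures on `Q_3` and `Q_k` over the `t`-cuts -/

variable (n) in
/-- The density of the uniform measure on `Q_3` (over the `t`-cuts): `1/|Q_3|` on `Q_3`.
[cite: Rothvoss2017, §2 (PDF p. 6)] -/
def wA (t : ℕ) (U : OddSet n) (M : PMatch n) : ℝ :=
  if (U, M) ∈ Qset n t 3 then (1 : ℝ) / (Qset n t 3).card else 0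

variable (n) in
/-- `1/((k-1)|Q_k|)` on `Q_k` (the density of the uniform measure on `Q_k` divided by `k-1`).
[cite: Rothvoss2017, §2 (PDF p. 6)] -/
def wB (t k : ℕ) (U : OddSet n) (M : PMatch n) : ℝ :=
  if (U, M) ∈ Qset n t k then (1 : ℝ) / (((k : ℝ) - 1) * (Qset n t k).card) else 0

variable (n) in
/-- Rothvoß's weights restricted to the `t`-cuts: `W = 1_{Q_3}/|Q_3| - 1_{Q_k}/((k-1)|Q_k|)`
(the `-∞` on `Q_1` is the support condition on rectangles). [cite: Rothvoss2017, §2 (PDF p. 6)] -/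
def rweight (t k : ℕ) (U : OddSet n) (M : PMatch n) : ℝ := wA n t U M - wB n t k U M

/-- `wA ≠ 0` only on `Q_3`. [folklore] -/
theorem cc_of_wA_ne_zero {t : ℕ} {U : OddSet n} {M : PMatch n} (h : wA n t U M ≠ 0) : cc U M = 3 := by
  unfold wA at h
  by_cases hmem : (U, M) ∈ Qset n t 3
  · exact (mem_Qset_iff.1 hmem).2
  · rw [if_neg hmem] at h
    exact absurd rfl h

/-- `wB ≠ 0` only on `Q_k`. [folklore] -/
theorem cc_of_wB_ne_zero {t k : ℕ} {U : OddSet n} {M : PMatch n} (h : wB n t k U M ≠ 0) :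
    cc U M = k := by
  unfold wB at h
  by_cases hmem : (U, M) ∈ Qset n t k
  · exact (mem_Qset_iff.1 hmem).2
  · rw [if_neg hmem] at h
    exact absurd rfl h

/-- `Σ wA = 1` when `Q_3 ≠ ∅`. [folklore] -/
theorem sum_wA {t : ℕ} (h3 : (Qset n t 3).Nonempty) : ∑ U : OddSet n, ∑ M : PMatch n, wA n t U M = 1 := by
  unfold wA
  rw [sum_sum_ite_mem, sum_const, nsmul_eq_mul, mul_one_div, div_self]
  exact_mod_cast (card_pos.2 h3).ne'

/-- `(k-1) Σ wB ≤ 1`. [folklore] -/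
theorem sum_wB_mul_le {t k : ℕ} (hk : 2 ≤ k) :
    (∑ U : OddSet n, ∑ M : PMatch n, wB n t k U M) * ((k : ℝ) - 1) ≤ 1 := by
  have hk1 : (0 : ℝ) < (k : ℝ) - 1 := by
    have : (2 : ℝ) ≤ k := by exact_mod_cast hk
    linarith
  unfold wB
  rw [sum_sum_ite_mem, sum_const, nsmul_eq_mul]
  by_cases hc : ((Qset n t k).card : ℝ) = 0
  · rw [hc]; norm_num
  · rw [mul_one_div]
    have : ((Qset n t k).card : ℝ) / (((k : ℝ) - 1) * (Qset n t k).card) * ((k : ℝ) - 1) = 1 := by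
      field_simp
    rw [this]

/-- **The rweight of a rectangle is `μ_3 - μ_k/(k-1)`.** [cite: Rothvoss2017, §3 (PDF p. 8: "⟨W,R⟩ = μ_3(R) - μ_k(R)/(k-1)")] -/
theorem sum_weight_rectangle {t k : ℕ} (X : Finset (OddSet n)) (Y : Finset (PMatch n)) :
    ∑ U ∈ X, ∑ M ∈ Y, rweight n t k U M = mu n t 3 X Y - mu n t k X Y / ((k : ℝ) - 1) := by
  simp only [rweight, wA, wB, sum_sub_distrib]
  rw [sum_product_ite_mem, sum_product_ite_mem, sum_const, sum_const, nsmul_eq_mul, nsmul_eq_mul,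
    mu, mu]
  congr 1
  · rw [mul_one_div]
  · rw [mul_one_div, div_div, mul_comm ((k : ℝ) - 1)]

/-! ### `Q_3 ≠ ∅`: the pair matching and a `t`-cut crossed three times -/

variable (n) in
/-- The perfect matching `{ {2i, 2i+1} }` of `K_n` (`n` even). [folklore] -/
def pairMatching : Finset (Sym2 (Fin n)) :=
  univ.filter fun e => ∃ a b : Fin n, e = s(a, b) ∧ (b : ℕ) = a + 1 ∧ (a : ℕ) % 2 = 0

/-- Membership of an edge in the pair matching. [folklore] -/
theorem mk_mem_pairMatching_iff {a b : Fin n} : s(a, b) ∈ pairMatching n ↔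
    ((b : ℕ) = a + 1 ∧ (a : ℕ) % 2 = 0) ∨ ((a : ℕ) = b + 1 ∧ (b : ℕ) % 2 = 0) := by
  simp only [pairMatching, mem_filter, mem_univ, true_and]
  constructor
  · rintro ⟨a', b', h, h1, h2⟩
    rcases Sym2.eq_iff.1 h with ⟨rfl, rfl⟩ | ⟨rfl, rfl⟩
    · exact Or.inl ⟨h1, h2⟩
    · exact Or.inr ⟨h1, h2⟩
  · rintro (⟨h1, h2⟩ | ⟨h1, h2⟩)
    · exact ⟨a, b, rfl, h1, h2⟩
    · exact ⟨b, a, Sym2.eq_swap, h1, h2⟩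

/-- **The pair matching is a perfect matching** when `n` is even. [folklore] -/
theorem isPMOn_pairMatching (hn : n % 2 = 0) :
    IsPMOn (Finset.univ : Finset (Fin n)) (pairMatching n) := by
  refine isPMOn_univ_of_existsUnique (fun e he => ?_) (fun v => ?_)
  · obtain ⟨a, b, rfl, h1, -⟩ := (mem_filter.1 he).2
    rw [Sym2.mk_isDiag_iff]
    intro h
    rw [h] at h1
    omega
  · by_cases hv : (v : ℕ) % 2 = 0
    · have hlt : (v : ℕ) + 1 < n := by omega
      refine ⟨⟨(v : ℕ) + 1, hlt⟩, mk_mem_pairMatching_iff.2 (Or.inl ⟨rfl, hv⟩), fun w hw => ?_⟩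
      rcases mk_mem_pairMatching_iff.1 hw with ⟨h1, -⟩ | ⟨h1, h2⟩
      · exact Fin.ext h1
      · omega
    · have hpos : 0 < (v : ℕ) := by
        by_contra h
        have : (v : ℕ) = 0 := by omega
        rw [this] at hv
        exact hv rfl
      refine ⟨⟨(v : ℕ) - 1, by omega⟩, mk_mem_pairMatching_iff.2 (Or.inr ⟨?_, ?_⟩), fun w hw => ?_⟩
      · simp only; omega
      · simp only; omega
      · rcases mk_mem_pairMatching_iff.1 hw with ⟨-, h2⟩ | ⟨h1, -⟩
        · exact absurd h2 hv
        · exact Fin.ext (by simp only; omega)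

/-- **`Q_3` is nonempty** once `t` is odd, `t ≥ 3` and `t + 3 ≤ n` (`n` even): the `t`-cut
`{0, …, t-4} ∪ {t-3, t-1, t+1}` is crossed by exactly the three pair-matching edges at
`t-3, t-1, t+1`. [cite: Rothvoss2017, §2 (PDF p. 6: ⟨W,S⟩ = 1 uses |Q_3| > 0)] -/
theorem qset_three_nonempty {t : ℕ} (hn : n % 2 = 0) (ht : t % 2 = 1) (ht3 : 3 ≤ t)
    (htn : t + 3 ≤ n) : (Qset n t 3).Nonempty := by
  classical
  -- the cut
  let x1 : Fin n := ⟨t - 3, by omega⟩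
  let x2 : Fin n := ⟨t - 1, by omega⟩
  let x3 : Fin n := ⟨t + 1, by omega⟩
  let U : Finset (Fin n) := Finset.Iio x1 ∪ {x1, x2, x3}
  have hmemU : ∀ v : Fin n, v ∈ U ↔ (v : ℕ) < t - 3 ∨ (v : ℕ) = t - 3 ∨ (v : ℕ) = t - 1 ∨
      (v : ℕ) = t + 1 := by
    intro v
    simp only [U, mem_union, Finset.mem_Iio, mem_insert, mem_singleton, Fin.ext_iff, Fin.lt_def,
      x1, x2, x3]
  have hcardU : U.card = t := by
    have hdisj : Disjoint (Finset.Iio x1) {x1, x2, x3} := by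
      rw [Finset.disjoint_left]
      intro v hv hv'
      simp only [Finset.mem_Iio, Fin.lt_def, x1] at hv
      simp only [mem_insert, mem_singleton, Fin.ext_iff, x1, x2, x3] at hv'
      omega
    rw [card_union_of_disjoint hdisj, Fin.card_Iio]
    have h12 : x1 ≠ x2 := by simp [x1, x2, Fin.ext_iff]; omega
    have h13 : x1 ≠ x3 := by simp [x1, x3, Fin.ext_iff]; omega
    have h23 : x2 ≠ x3 := by simp [x2, x3, Fin.ext_iff]
    rw [card_insert_of_notMem (by simp [h12, h13]), card_pair h23]
    simp only [x1]
    omega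
  have hoddU : Odd U.card := by rw [hcardU]; exact Nat.odd_iff.2 ht
  -- the crossing edges of the pair matching
  let M := pairMatching n
  have hM : IsPMOn (Finset.univ : Finset (Fin n)) M := isPMOn_pairMatching hn
  let nxt : Fin n → Sym2 (Fin n) := fun a => s(a, hM.partner a)
  have hcross : M.filter (Crosses U) = ({x1, x2, x3} : Finset (Fin n)).image nxt := by
    ext e
    simp only [mem_filter, mem_image, mem_insert, mem_singleton, crosses_iff_exists]
    constructor
    · rintro ⟨he, a, b, rfl, ha, hb⟩
      have hb' : b = hM.partner a := hM.eq_partner_of_mem he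
      rw [hmemU] at ha hb
      rcases mk_mem_pairMatching_iff.1 he with ⟨h1, h2⟩ | ⟨h1, h2⟩
      · -- `b = a + 1`, `a` even: `a ∈ {t-3, t-1, t+1}`
        have : (a : ℕ) = t - 3 ∨ (a : ℕ) = t - 1 ∨ (a : ℕ) = t + 1 := by omega
        refine ⟨a, ?_, by rw [hb']⟩
        simp only [Fin.ext_iff, x1, x2, x3]
        exact this
      · -- `a = b + 1`, `b` even: impossible
        exfalso
        omega
    · rintro ⟨a, ha, rfl⟩
      have hval : (a : ℕ) = t - 3 ∨ (a : ℕ) = t - 1 ∨ (a : ℕ) = t + 1 := by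
        simpa only [Fin.ext_iff, x1, x2, x3] using ha
      have haeven : (a : ℕ) % 2 = 0 := by omega
      have hlt : (a : ℕ) + 1 < n := by omega
      have hpart : hM.partner a = ⟨(a : ℕ) + 1, hlt⟩ :=
        (hM.eq_partner_of_mem (mk_mem_pairMatching_iff.2 (Or.inl ⟨rfl, haeven⟩))).symm
      refine ⟨hM.mk_partner_mem a, a, hM.partner a, rfl, ?_, ?_⟩
      · rw [hmemU]; omega
      · rw [hmemU, hpart]; simp only; omega
  have hinj : Set.InjOn nxt ↑({x1, x2, x3} : Finset (Fin n)) := by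
    intro a ha b hb h
    have ha' : a ∈ ({x1, x2, x3} : Finset (Fin n)) := Finset.mem_coe.1 ha
    have hb' : b ∈ ({x1, x2, x3} : Finset (Fin n)) := Finset.mem_coe.1 hb
    have hva : (a : ℕ) = t - 3 ∨ (a : ℕ) = t - 1 ∨ (a : ℕ) = t + 1 := by
      simpa only [mem_insert, mem_singleton, Fin.ext_iff, x1, x2, x3] using ha'
    have hvb : (b : ℕ) = t - 3 ∨ (b : ℕ) = t - 1 ∨ (b : ℕ) = t + 1 := by
      simpa only [mem_insert, mem_singleton, Fin.ext_iff, x1, x2, x3] using hb'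
    have hbeven : (b : ℕ) % 2 = 0 := by omega
    have hltb : (b : ℕ) + 1 < n := by omega
    have hpb : hM.partner b = ⟨(b : ℕ) + 1, hltb⟩ :=
      (hM.eq_partner_of_mem (mk_mem_pairMatching_iff.2 (Or.inl ⟨rfl, hbeven⟩))).symm
    have hmem : a ∈ s(b, hM.partner b) := by
      rw [show s(b, hM.partner b) = nxt b from rfl, ← h]
      exact Sym2.mem_mk_left _ _
    rcases Sym2.mem_iff.1 hmem with h' | h'
    · exact h'
    · exfalso
      have : (a : ℕ) = (b : ℕ) + 1 := by rw [h', hpb]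
      omega
  refine ⟨(⟨U, hoddU⟩, ⟨M, hM⟩), mem_Qset_iff.2 ⟨hcardU, ?_⟩⟩
  show (M.filter (Crosses U)).card = 3
  rw [hcross, card_image_of_injOn hinj]
  have h12 : x1 ≠ x2 := by simp [x1, x2, Fin.ext_iff]; omega
  have h13 : x1 ≠ x3 := by simp [x1, x3, Fin.ext_iff]; omega
  have h23 : x2 ≠ x3 := by simp [x2, x3, Fin.ext_iff]
  rw [card_insert_of_notMem (by simp [h12, h13]), card_pair h23]

/-- **Rothvoß 2017, Cor. 2, assembled (printed form): Lemma 7's rectangle bound implies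
`xc(TSP(N)) ≥ 2^{Ω(N)}`.** Hypothesis = Lemma 6 in the rectangle form of Lemma 7: for some odd
`k ≥ 5`, `δ > 0`, `m₀`, every rectangle `X × Y` of `t`-node cuts and perfect matchings of `K_n`
(`n = 3m(k-3) + 2k`, `t = (m+1)(k-3)/2 + 3`, `m ≥ m₀` odd) with `μ_1(X × Y) = 0` has
`μ_3(X × Y) ≤ μ_k(X × Y)/(k-1) + 2^{-δm}`. Conclusion: the named fact `Rothvoss2017_tsp`
(`rothvoss2017_tsp_of_weights` with the uniform weights `rweight n t k`; `Q_3 ≠ ∅` by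
`qset_three_nonempty`). [cite: Rothvoss2017, Lemma 6, Lemma 7 and §2 (PDF pp. 6–8), Cor. 2 (PDF p. 4)] -/
theorem rothvoss2017_tsp_of_rectangle_bound {k : ℕ} (hk : 5 ≤ k) (hko : k % 2 = 1) {δ : ℝ}
    (hδ : 0 < δ) {m₀ : ℕ}
    (hL6 : ∀ m : ℕ, m₀ ≤ m → m % 2 = 1 →
      ∀ (X : Finset (OddSet (3 * m * (k - 3) + 2 * k))) (Y : Finset (PMatch (3 * m * (k - 3) + 2 * k))),
        (∀ U ∈ X, ∀ M ∈ Y, cc U M ≠ 1) →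
        mu (3 * m * (k - 3) + 2 * k) ((m + 1) / 2 * (k - 3) + 3) 3 X Y ≤
          mu (3 * m * (k - 3) + 2 * k) ((m + 1) / 2 * (k - 3) + 3) k X Y / ((k : ℝ) - 1) +
            (2 : ℝ) ^ (-(δ * m))) :
    Rothvoss2017_tsp := by
  refine rothvoss2017_tsp_of_weights (k := k) (by omega) hδ (m₀ := max m₀ 1) fun m hm hmo => ?_
  have hm₀ : m₀ ≤ m := le_trans (le_max_left _ _) hm
  have hm1 : 1 ≤ m := le_trans (le_max_right _ _) hm
  obtain ⟨hn2, ht2, ht3, htn⟩ := rothvoss_params (m := m) hk hko hm1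
  have hk2 : 2 ≤ k := by omega
  refine ⟨wA (3 * m * (k - 3) + 2 * k) ((m + 1) / 2 * (k - 3) + 3),
    wB (3 * m * (k - 3) + 2 * k) ((m + 1) / 2 * (k - 3) + 3) k,
    fun U M h => cc_of_wA_ne_zero h, fun U M h => cc_of_wB_ne_zero h,
    sum_wA (qset_three_nonempty hn2 ht2 ht3 htn), sum_wB_mul_le hk2, fun X Y hXY => ?_⟩
  have h1 := sum_weight_rectangle (n := 3 * m * (k - 3) + 2 * k)
    (t := (m + 1) / 2 * (k - 3) + 3) (k := k) X Y
  simp only [rweight] at h1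
  rw [h1]
  linarith [hL6 m hm₀ hmo X Y hXY]

end Literature.Barriers.PneNP
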